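import Summits.HodgeConjecture.HodgeConjecture.Theorems.K2E1ChiScatteringMiddlePoleU3   -- ★ F5 (R90-C133-p02): `residue_at_threeHalves_ne_zero_of_lHalfNeZero_cm_three`; brings ★ `LHalfNeZero`, `partialStandardL`, `HeckeCharacter`
import HarnessLib

/-!
# K2·E1 — `K2E1ChiScatteringPoleSectionLimitCMThree`: THE SCATTERING-POLE LETTER FROM A FACTORED INTERTWINED TERM — `(z − z₀)·ψ_z(g) → ρ·φ̃_{z₀}(g)`

Track B ∕ K2-LIT, crux h413 = `stmt-HodgeConjecture-24833`, route `HCCMUnconditional`; cell `hodgecm-mathlib`, R90-TF section S8, deal S8-R95 (R90-CS-plan (g2)) «→ K2E2-p12 (g8)»: pays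
the scattering-pole letter `hψ` of ★ p862836 `K2E1ChiBorelConstantTermMiddleResidueCMThree.tendsto_sub_mul_borelConstantTerm_middle` (hence the (V) seam's `hCT`∕`hΨ`, ★ p862780) from a
FACTORED intertwined term `ψ_z(g) = qc(z)·φ̃_z(g)` (`qc` = ★ F5's normalised scattering quotient, `φ̃_z` = the normalised intertwined section, continuous in `z` at the pole) and the scalar
residue-limit `(z − z₀)·qc(z) → ρ` (★ F5).  THEOREMS ONLY (no `def`, no `instance`, no notation, no named-fact hypothesis, no `sorry`; default heartbeats); count-neutral.
* §1 **`tendsto_sub_mul_of_factor`** — generic (any pole `z₀`, any argument type): `hfac` + `ContinuousAt (φ̃ · g) z₀` + `(z − z₀)·qc z → ρ` ⊢ `(z − z₀)·ψ z g → ρ·φ̃ z₀ g`.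
* §2 **`tendsto_sub_mul_middle_of_factor_cm_three`**, **`middle_residue_mul_section_ne_zero_cm_three`** — the CM middle pole `z₀ = 3/2` with ★ F5: under F5's letters and
  `L(½, φ) ≠ 0`, `ρ·φ̃_{3/2}(g₀) ≠ 0` as soon as `φ̃_{3/2}(g₀) ≠ 0` — so the (V) seam's `hψ`∕`hΨ` reduce to «`hfac` + local intertwining non-vanishing `φ̃_{3/2}(g₀) ≠ 0`» (the remaining letter, named).
HONEST LABEL: HC_CM is proved only modulo the 7 printed citations (2 remaining named inputs: hLiu418 = `stmt-HodgeConjecture-24832`, h413 = `stmt-HodgeConjecture-24833`) until rung 0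
closes; shrinks a (V) letter to `hfac` + non-vanishing, closes nothing; count-neutral.

## References
* [MoeglinWaldspurger1995] C. Mœglin, J.-L. Waldspurger, *Spectral Decomposition and Eisenstein Series* (1995), IV.1.11 (residues of Eisenstein series and of the intertwining term).
* [Rogawski1990] J. D. Rogawski, *Automorphic Representations of Unitary Groups in Three Variables* (1990), §13.9 (ii) p. 229.
-/

set_option autoImplicit false
-- the mandated namespace repeats the single-problem summit's segment (`HodgeConjecture.HodgeConjecture`)
set_option linter.dupNamespace false

noncomputable section

open scoped NNReal
open Set Filter Topology Complex NumberField IsDedekindDomain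
open Literature.NumberTheory.Automorphic Literature.NumberTheory.LFunctions Literature.NumberTheory.GaloisRepresentations
open Summit.HodgeConjecture.HodgeConjecture.Cruxes.H413.K2E1HeckeLHalfNeZeroDefs (LHalfNeZero)
open Summit.HodgeConjecture.HodgeConjecture.Cruxes.H413.K2E1ChiScatteringMiddlePoleU3 (residue_at_threeHalves_ne_zero_of_lHalfNeZero_cm_three)

namespace Summit.HodgeConjecture.HodgeConjecture.Cruxes.H413.K2E1ChiScatteringPoleSectionLimitCMThree

/-! ## §1 Generic: the residue of a factored term -/

/-- **`(z − z₀)·ψ_z(g) → ρ·φ̃_{z₀}(g)`** when `ψ_z(g) = qc(z)·φ̃_z(g)` eventually along `𝓝[≠] z₀`, `z ↦ φ̃_z(g)` is continuous at `z₀`, and `(z − z₀)·qc(z) → ρ` (product of limits).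
[cite: MoeglinWaldspurger1995, IV.1.11] -/
theorem tendsto_sub_mul_of_factor {X : Type*} {z₀ : ℂ} (ψ : ℂ → X → ℂ) (qc : ℂ → ℂ) (φt : ℂ → X → ℂ)
    (hfac : ∀ᶠ z in 𝓝[≠] z₀, ∀ g, ψ z g = qc z * φt z g) (hφt : ∀ g, ContinuousAt (fun z => φt z g) z₀)
    {ρ : ℂ} (hρ : Tendsto (fun z : ℂ => (z - z₀) * qc z) (𝓝[≠] z₀) (𝓝 ρ)) (g : X) :
    Tendsto (fun z : ℂ => (z - z₀) * ψ z g) (𝓝[≠] z₀) (𝓝 (ρ * φt z₀ g)) := by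
  have h := hρ.mul (tendsto_nhdsWithin_of_tendsto_nhds (hφt g).tendsto)
  refine h.congr' ?_
  filter_upwards [hfac] with z hz
  rw [hz g, mul_assoc]

/-- The residue of the factored term is non-zero where the section is, for a non-zero scalar residue. [cite: MoeglinWaldspurger1995, IV.1.11] -/
theorem residue_mul_section_ne_zero {X : Type*} {ρ : ℂ} (hρ0 : ρ ≠ 0) (φt0 : X → ℂ) {g₀ : X} (h : φt0 g₀ ≠ 0) : ρ * φt0 g₀ ≠ 0 :=
  mul_ne_zero hρ0 h

/-! ## §2 The CM middle pole `z₀ = 3/2` with ★ F5 -/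

variable (L : Type) [Field L] [NumberField L]

/-- **THE SCATTERING-POLE LETTER AT THE MIDDLE POLE, FACTORED FORM**: `(z − 3/2)·ψ_z(g) → ρ·φ̃_{3/2}(g)` for every `g`, from `hfac`, continuity of `φ̃_·(g)` at `3/2` and ★ F5's
residue-limit `(z − 3/2)·qc z → ρ` — exactly the `hψ` binder of ★ `tendsto_sub_mul_borelConstantTerm_middle` with `φt := φ̃_{3/2}`. [cite: MoeglinWaldspurger1995, IV.1.11] [cite: Rogawski1990, §13.9 (ii) p. 229] -/
theorem tendsto_sub_mul_middle_of_factor_cm_three {X : Type*} (ψ : ℂ → X → ℂ) (qc : ℂ → ℂ) (φt : ℂ → X → ℂ)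
    (hfac : ∀ᶠ z in 𝓝[≠] ((3 : ℂ) / 2), ∀ g, ψ z g = qc z * φt z g) (hφt : ∀ g, ContinuousAt (fun z => φt z g) ((3 : ℂ) / 2))
    {ρ : ℂ} (hρ : Tendsto (fun z : ℂ => (z - 3 / 2) * qc z) (𝓝[≠] (3 / 2)) (𝓝 ρ)) :
    ∀ g, Tendsto (fun z : ℂ => (z - (3 : ℂ) / 2) * ψ z g) (𝓝[≠] ((3 : ℂ) / 2)) (𝓝 (ρ * φt ((3 : ℂ) / 2) g)) :=
  fun g => tendsto_sub_mul_of_factor ψ qc φt hfac hφt hρ g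

/-- **`ρ·φ̃_{3/2}(g₀) ≠ 0` UNDER `L(½, φ) ≠ 0`** — ★ F5 `residue_at_threeHalves_ne_zero_of_lHalfNeZero_cm_three` (its letters VERBATIM: `hsrc`, `A (3/2) ≠ 0`, `η = 1`, `φ ≠ 1`) makes the
scalar residue `ρ` non-zero, so the (V) seam's `hΨ` reduces to the LOCAL INTERTWINING NON-VANISHING `φ̃_{3/2}(g₀) ≠ 0` (the remaining letter, named `hφt0`).
[cite: Rogawski1990, §13.9 (ii) p. 229] [cite: MoeglinWaldspurger1995, IV.1.11] -/
theorem middle_residue_mul_section_ne_zero_cm_three {φ : HeckeCharacter L} {η : HeckeCharacter ↥(maximalRealSubfield L)}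
    {S : Set (HeightOneSpectrum (𝓞 L))} {T : Set (HeightOneSpectrum (𝓞 ↥(maximalRealSubfield L)))}
    (hφ : φ.IsUnitary) (hφA : ∀ t : ℝ≥0ˣ, φ (posRealIdele L t) = 1) (hS : S.Finite) (hurφ : ∀ w ∉ S, φ.IsUnramifiedAt w)
    (hη : η.IsUnitary) (hηA : ∀ t : ℝ≥0ˣ, η (posRealIdele ↥(maximalRealSubfield L) t) = 1) (hT : T.Finite) (hurη : ∀ v ∉ T, η.IsUnramifiedAt v)
    (q qc : ℂ → ℂ) {P : Set ℂ} (hqcq : ∀ z : ℂ, 2 < z.re → qc z = q z) (hPcd : ∀ z₀ : ℂ, ∀ᶠ s in 𝓝[≠] z₀, s ∉ P) (hqa : ∀ z : ℂ, z ∉ P → AnalyticAt ℂ qc z)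
    (A : ℂ → ℂ) (hA : DifferentiableOn ℂ A {z : ℂ | 1 < z.re})
    (hsrc : ∀ z : ℂ, 2 < z.re → q z = A z *
          ((partialStandardL S (fun w => {φ.valueAtUniformizer w}) (z - 1) * partialStandardL T (fun v => {η.valueAtUniformizer v}) (2 * z - 2)) /
            (partialStandardL S (fun w => {φ.valueAtUniformizer w}) z * partialStandardL T (fun v => {η.valueAtUniformizer v}) (2 * z - 1))))
    (hη1 : η = 1) (hφ1 : φ ≠ 1) (hL : LHalfNeZero φ) (hA32 : A (3 / 2) ≠ 0)
    {ρ : ℂ} (hρ : Tendsto (fun z : ℂ => (z - 3 / 2) * qc z) (𝓝[≠] (3 / 2)) (𝓝 ρ))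
    {X : Type*} (φt0 : X → ℂ) {g₀ : X} (hφt0 : φt0 g₀ ≠ 0) : ρ * φt0 g₀ ≠ 0 :=
  residue_mul_section_ne_zero
    (residue_at_threeHalves_ne_zero_of_lHalfNeZero_cm_three L hφ hφA hS hurφ hη hηA hT hurη q qc hqcq hPcd hqa A hA hsrc hη1 hφ1 hL hA32 hρ) φt0 hφt0

end Summit.HodgeConjecture.HodgeConjecture.Cruxes.H413.K2E1ChiScatteringPoleSectionLimitCMThree

end
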